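import Summits.Langlands.Langlands.Theses.DyadicOddResidue
import Literature.NumberTheory.GaloisRepresentations.AbsolutelyIrreducibleReductionBridge

/-!
# `DyadicDihedralFM` (crux stmt-Langlands-18742, route `DyadicOddResidue`): the hypothesis
# `ρ.toGaloisRep.IsIrreducible` is REDUNDANT — it follows from `ρ.IsResiduallyAbsIrreducible`
# (negative-side support, refuter cdisprove seat; hypothesis-mutation finding, sorry-free)

`DyadicDihedralFM` quantifies over continuous `ρ : Γ_ℚ → GL₂(ℚ̄₂)` with, among others, the two
hypotheses `hres : ρ.IsResiduallyAbsIrreducible` ("`ρ̄` absolutely irreducible": some reduction of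
an integral model over `ℤ̄₂` is absolutely irreducible) and `hirr : ρ.toGaloisRep.IsIrreducible`.
We record, kernel-checked, that `hirr` carries no information beyond `hres`:

* `isIrreducible_of_isResiduallyAbsIrreducible` — for every field `K`, prime `ℓ` and `n ≥ 1`, a
  residually absolutely irreducible `ρ : Γ_K → GL_n(ℚ̄_ℓ)` is irreducible. Proof (Burnside, twice):
  by the accepted bridge `FramedGaloisRep.hasAbsolutelyIrreducibleReduction_iff_isResiduallyAbsIrreducible`
  some integral frame `g` and `n²` elements `s a ∈ Γ_K` have an `n² × n²` matrix of entries of the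
  `g ρ(s a) g⁻¹` of norm-one determinant; a norm-one scalar is non-zero, so these `n²` matrices are
  a basis of `M_n(ℚ̄_ℓ)` (`FramedRep.isUnit_of_entries_iff_span_eq_top`), hence so is the image of
  `ρ` after undoing the frame (`span_range_units_conj_eq_top_iff`), and a representation whose
  image spans `M_n` is irreducible (`isIrreducible_of_span_eq_top`). (Darmon–Diamond–Taylor,
  *Fermat's Last Theorem* §2.1; Curtis–Reiner (27.4).)
* `dyadicDihedralFM_iff_without_isIrreducible` — hence the crux is EQUIVALENT to the same statement
  with the binder `ρ.toGaloisRep.IsIrreducible →` deleted (stated inline; no proposition is defined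
  under `Summits/`).

Moral for provers / planners: dropping `hirr` changes nothing (no proof can "use" it in an
essential way — it is recoverable from `hres` in one line); the load-bearing residual hypotheses
are `hres` (absolute irreducibility of `ρ̄`, which at `ℓ = 2` also forces `tr ρ̄ ≢ 0`-type
bigness only in the weak Burnside sense) and `IsSolvable ρ.residualRep.range` (the dihedral cell).
This file does NOT refute the crux.
-/

noncomputable section

set_option linter.dupNamespace false

namespace Summit.Langlands.Langlands.Theorems.DyadicDihedralFM.Negative

open scoped MatrixGroups
open Literature.NumberTheory.GaloisRepresentations Literature.RepresentationTheory.Semisimple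

/-- **Residually absolutely irreducible ⇒ irreducible** (`n ≥ 1`, coefficients `ℚ̄_ℓ`): if some
reduction `ρ̄ : Γ_K → GL_n(ℤ̄_ℓ/𝔪)` of `ρ : Γ_K → GL_n(ℚ̄_ℓ)` is absolutely irreducible then the
matrices `ρ(σ)` span `M_n(ℚ̄_ℓ)`, so `ρ` is irreducible (indeed absolutely irreducible).
(Darmon–Diamond–Taylor 1995, §2.1; Curtis–Reiner (27.4).) -/
theorem isIrreducible_of_isResiduallyAbsIrreducible {K : Type*} [Field K] {ℓ : ℕ} [Fact ℓ.Prime]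
    {n : ℕ} (hn : 0 < n) (ρ : FramedGaloisRep K (PadicAlgCl ℓ) n)
    (h : ρ.IsResiduallyAbsIrreducible) : ρ.toGaloisRep.IsIrreducible := by
  -- Burnside form of residual absolute irreducibility (accepted bridge)
  obtain ⟨g, s, -, hdet⟩ :=
    (FramedGaloisRep.hasAbsolutelyIrreducibleReduction_iff_isResiduallyAbsIrreducible hn ρ).2 h
  -- a norm-one determinant is a unit of the field `ℚ̄_ℓ`
  have hU : IsUnit (Matrix.of fun a b : Fin n × Fin n =>
      ((g * ρ (s a) * g⁻¹ : GL (Fin n) (PadicAlgCl ℓ)) :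
        Matrix (Fin n) (Fin n) (PadicAlgCl ℓ)) b.1 b.2) := by
    rw [Matrix.isUnit_iff_isUnit_det, isUnit_iff_ne_zero]
    intro h0
    rw [h0, norm_zero] at hdet
    exact zero_ne_one hdet
  -- so the `n²` conjugated matrices `g ρ(s a) g⁻¹` span `M_n(ℚ̄_ℓ)` …
  rw [FramedRep.isUnit_of_entries_iff_span_eq_top] at hU
  -- … a fortiori all the `g ρ(σ) g⁻¹` do …
  have hspan_conj : Submodule.span (PadicAlgCl ℓ) (Set.range fun σ =>
      ((g * ρ σ * g⁻¹ : GL (Fin n) (PadicAlgCl ℓ)) : Matrix (Fin n) (Fin n) (PadicAlgCl ℓ))) = ⊤ := by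
    refine eq_top_iff.2 (hU ▸ Submodule.span_mono ?_)
    rintro _ ⟨a, rfl⟩
    exact ⟨s a, rfl⟩
  -- … and, undoing the frame, so do the `ρ(σ)` themselves
  have hspan : Submodule.span (PadicAlgCl ℓ) (Set.range fun σ =>
      ((ρ σ : GL (Fin n) (PadicAlgCl ℓ)) : Matrix (Fin n) (Fin n) (PadicAlgCl ℓ))) = ⊤ := by
    rw [← span_range_units_conj_eq_top_iff g⁻¹, inv_inv]
    have e : (fun σ => ((g : GL (Fin n) (PadicAlgCl ℓ)) : Matrix (Fin n) (Fin n) (PadicAlgCl ℓ)) *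
        ((ρ σ : GL (Fin n) (PadicAlgCl ℓ)) : Matrix (Fin n) (Fin n) (PadicAlgCl ℓ)) *
        ((g⁻¹ : GL (Fin n) (PadicAlgCl ℓ)) : Matrix (Fin n) (Fin n) (PadicAlgCl ℓ))) =
        fun σ => ((g * ρ σ * g⁻¹ : GL (Fin n) (PadicAlgCl ℓ)) :
          Matrix (Fin n) (Fin n) (PadicAlgCl ℓ)) := by
      funext σ
      rw [Units.val_mul, Units.val_mul]
    rw [e]
    exact hspan_conj
  -- Burnside: spanning `M_n` forces irreducibility of the representation on `ℚ̄_ℓⁿ`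
  -- (phrased through `ρ.toMonoidHom`, definitionally the representation underlying `toGaloisRep`)
  have hspan' : Submodule.span (PadicAlgCl ℓ) (Set.range fun σ =>
      ((ρ.toMonoidHom σ : GL (Fin n) (PadicAlgCl ℓ)) : Matrix (Fin n) (Fin n) (PadicAlgCl ℓ))) = ⊤ :=
    hspan
  have key : Representation.IsIrreducible
      ((glStdRepresentation (Fin n) (PadicAlgCl ℓ)).comp ρ.toMonoidHom) :=
    isIrreducible_of_span_eq_top hn ρ.toMonoidHom hspan'
  exact key

/-- **`hirr` is redundant in `DyadicDihedralFM`.** The crux is equivalent to the statement obtained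
by deleting the binder `ρ.toGaloisRep.IsIrreducible →` (everything else verbatim): the forward
direction feeds `isIrreducible_of_isResiduallyAbsIrreducible` (rank `2 > 0`), the converse is
weakening. Hypothesis-mutation record for the provers: any proof may assume irreducibility for
free, and no refutation can come from a reducible `ρ`. -/
theorem dyadicDihedralFM_iff_without_isIrreducible :
    Summit.Langlands.Langlands.Theses.DyadicOddResidue.DyadicDihedralFM ↔
    (∀ (ℓ : ℕ) [Fact ℓ.Prime], ℓ = 2 →
      ∀ (ρ : Literature.NumberTheory.GaloisRepresentations.FramedGaloisRep ℚ (PadicAlgCl ℓ) 2),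
      ρ.IsResiduallyAbsIrreducible → IsSolvable ρ.residualRep.range → ρ.IsOdd →
      (∀ᶠ v : IsDedekindDomain.HeightOneSpectrum (NumberField.RingOfIntegers ℚ) in Filter.cofinite,
        ρ.IsUnramifiedAt v) →
      (∀ (v : IsDedekindDomain.HeightOneSpectrum (NumberField.RingOfIntegers ℚ))
        (hv : ((ℓ : ℕ) : NumberField.RingOfIntegers ℚ) ∈ v.asIdeal),
        (Literature.NumberTheory.PAdicHodge.fontainePstAdicCompletion v ℓ hv).IsDeRhamFramed
          (ρ.toLocal v) ∧
        ∀ τ : v.adicCompletion ℚ →+* PadicAlgCl ℓ, Continuous τ →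
          (ρ.labelledHodgeTateWeightsAt v
            (Literature.NumberTheory.PAdicHodge.fontainePstAdicCompletion v ℓ hv).algebra
            (Literature.NumberTheory.PAdicHodge.fontainePstAdicCompletion v ℓ hv).𝔅 τ).Nodup) →
      ∀ (hcpt : Literature.NumberTheory.Automorphic.isCompact_glFiniteIntegralLevel 2 ℚ)
        (ι : PadicAlgCl ℓ ≃+* ℂ),
        ∃ π : Literature.NumberTheory.Automorphic.CuspidalAutomorphicRepData 2 ℚ hcpt,
          π.1.IsLAlgebraic ∧
          ∀ᶠ v : IsDedekindDomain.HeightOneSpectrum (NumberField.RingOfIntegers ℚ) in Filter.cofinite,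
            Summit.Langlands.SatakeFrobCompatibleAt ι π.1 ρ v) := by
  constructor
  · intro h ℓ _ hℓ ρ hres hsol hodd hunr hdR hcpt ι
    exact h ℓ hℓ ρ hres hsol (isIrreducible_of_isResiduallyAbsIrreducible two_pos ρ hres) hodd hunr
      hdR hcpt ι
  · intro h ℓ _ hℓ ρ hres hsol _ hodd hunr hdR hcpt ι
    exact h ℓ hℓ ρ hres hsol hodd hunr hdR hcpt ι

end Summit.Langlands.Langlands.Theorems.DyadicDihedralFM.Negative

end
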